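import Mathlib
import HarnessLib
import Summits.HubbardSuperconductivity.HubbardSuperconductivity.Theorems.KLProgrammeKLRegimeSplitLegDressing
import Summits.HubbardSuperconductivity.HubbardSuperconductivity.Theorems.KLProgrammeKLRegimeSplitThermalLayerExt

/-!
# Route `KLProgramme` — crux K3 split, ENGINE child (gen 3): the per-leg dressing size UNIFORMLY ON THE EXTENDED LADDER `n ≤ n_β + 1`
# (k3c2-p2's thermal factor `(π/β)/Λ_n ≤ 4` ⇒ the scale-uniform constant `βL²·(64·cr·4^{−n} + 32·cz)·|U|`) (cell gate-hubbard-kl, seat hubbard-kl-k3c2-p3)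

`klld_leg_dressing_le` (`…SplitLegDressing`) bounds the per-leg dressing by `βL²·(64·cr·|U|·4^{−n} + 16·cz·|U| + 4·cz·|U|·(π/β)/Λ_n)`.  On the
engine's ladder `n ≤ nScales β + 1` with `β ≥ klBetaMin` the temperature-to-scale ratio obeys `(π/β)/Λ_n ≤ 4` (`π/β ≤ Λ_{n_β}` — k3c2-p2's
`klth_pi_div_le_klScale_nScales` — and `Λ_{n_β} = 4·Λ_{n_β+1} ≤ 4·Λ_n`: k3c2-p2's `klte_ratio_le_four`; above the thermal layer it is even `≤ 4^{-(n_β−n)}`, `klth_ratio_le_inv_pow`),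
so the size is `≤ βL²·(64·cr·4^{−n} + 32·cz)·|U|` with constants independent of `β, L, M, n` — the form an engine proof carries in its bookkeeping
(residual part → `legDressBarQ`'s quadratic profile once multiplied by the value `Klam|U|`; the `32·cz·|U|` part is the SLOT reading of the
slope/field-strength dressing, which the engine replaces by its own second-order sizes, `…LegBudget`).  Pure arithmetic; nothing about the model.
-/

noncomputable section

namespace Summit.HubbardSuperconductivity.HubbardSuperconductivity.Theorems.KLRegimeSplit

set_option linter.dupNamespace false -- summit = problem name (single-conjunct summit), D-0017

open Real Finset Literature.MathematicalPhysics.QuantumLattice Literature.Probability.LatticeModels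
open Summit.HubbardSuperconductivity.HubbardSuperconductivity.Theorems.KLProgrammeLegKernels

section Model

variable {L M : ℕ} [NeZero L] [NeZero M]

/-- **THE PER-LEG DRESSING SIZE, UNIFORM ON THE LADDER**: under the history slots at `n − 1` as in `klld_leg_dressing_le`, for `β ≥ klBetaMin`
and `1 ≤ n ≤ nScales β + 1`,
`‖slice entry on the leg‖ · ‖Σ_{n−1}(ω₀,k⃗,σ)‖ ≤ βL² · (64·cr·4^{−n} + 32·cz) · |U|`. -/
theorem klld_leg_dressing_le_ladder {β U μ : ℝ} (hβ : klBetaMin ≤ β) {K : TrigPolyC4v} {R : RenConsts} (hcr : 0 ≤ R.cr)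
    (hcz : 0 ≤ R.cz) {n : ℕ} (hn : 1 ≤ n) (hN : n ≤ nScales β + 1) (hE0 : SelfEnergySymmetric L M β U μ K (n - 1))
    (hren : RenormalisedAtF L M β U μ K R (n - 1)) (hsl : TwoLegSlopes L M R β U μ K (n - 1)) (k : TorusSite 2 L) (σ c c' : Fin 2) :
    ‖hubbardCovSliceCT L M β μ 0 K (klScale klE0 n) (klScale klE0 (n - 1)) (((omega0 M, k), σ), c) (((omega0 M, k), σ), c')‖ *
        ‖klSelfEnergy L M β U μ K klE0 (n - 1) (omega0 M, k) σ‖ ≤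
      β * (L : ℝ) ^ 2 * ((64 * R.cr * ((4 : ℝ) ^ n)⁻¹ + 32 * R.cz) * |U|) := by
  have hβpos : 0 < β := pos_of_klBetaMin_le hβ
  have h := klld_leg_dressing_le (L := L) (M := M) hβpos hcr hcz hn hE0 hren hsl k σ c c'
  have hr := klte_ratio_le_four hβ hN
  have hβL : 0 ≤ β * (L : ℝ) ^ 2 := by positivity
  have hU := abs_nonneg U
  have hczU : 0 ≤ R.cz * |U| := mul_nonneg hcz hU
  have hmono : 64 * R.cr * |U| * ((4 : ℝ) ^ n)⁻¹ + 16 * R.cz * |U| + 4 * R.cz * |U| * ((Real.pi / β) / klScale klE0 n) ≤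
      (64 * R.cr * ((4 : ℝ) ^ n)⁻¹ + 32 * R.cz) * |U| := by
    nlinarith
  exact h.trans (mul_le_mul_of_nonneg_left hmono hβL)

/-- The summed form over the four legs of a configuration, uniform on the ladder: `≤ βL²·(64·cr·4^{−n} + 32·cz)·|U| · legSliceCountT … n legs`. -/
theorem klld_sum_leg_dressing_le_ladder {β U μ : ℝ} (hβ : klBetaMin ≤ β) {K : TrigPolyC4v} {R : RenConsts} (hcr : 0 ≤ R.cr)
    (hcz : 0 ≤ R.cz) {n : ℕ} (hn : 1 ≤ n) (hN : n ≤ nScales β + 1) (hE0 : SelfEnergySymmetric L M β U μ K (n - 1))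
    (hren : RenormalisedAtF L M β U μ K R (n - 1)) (hsl : TwoLegSlopes L M R β U μ K (n - 1)) (k : Fin 4 → TorusSite 2 L)
    (σ c c' : Fin 4 → Fin 2) :
    ∑ i : Fin 4, ‖hubbardCovSliceCT L M β μ 0 K (klScale klE0 n) (klScale klE0 (n - 1)) (((omega0 M, k i), σ i), c i)
        (((omega0 M, k i), σ i), c' i)‖ * ‖klSelfEnergy L M β U μ K klE0 (n - 1) (omega0 M, k i) (σ i)‖ ≤
      β * (L : ℝ) ^ 2 * ((64 * R.cr * ((4 : ℝ) ^ n)⁻¹ + 32 * R.cz) * |U|) * (legSliceCountT L β μ K n k : ℝ) := by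
  have hβpos : 0 < β := pos_of_klBetaMin_le hβ
  have h := klld_sum_leg_dressing_le (L := L) (M := M) hβpos hcr hcz hn hE0 hren hsl k σ c c'
  have hr := klte_ratio_le_four hβ hN
  have hβL : 0 ≤ β * (L : ℝ) ^ 2 := by positivity
  have hU := abs_nonneg U
  have hczU : 0 ≤ R.cz * |U| := mul_nonneg hcz hU
  have hmono : β * (L : ℝ) ^ 2 *
      (64 * R.cr * |U| * ((4 : ℝ) ^ n)⁻¹ + 16 * R.cz * |U| + 4 * R.cz * |U| * ((Real.pi / β) / klScale klE0 n)) ≤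
      β * (L : ℝ) ^ 2 * ((64 * R.cr * ((4 : ℝ) ^ n)⁻¹ + 32 * R.cz) * |U|) :=
    mul_le_mul_of_nonneg_left (by nlinarith) hβL
  exact h.trans (mul_le_mul_of_nonneg_right hmono (Nat.cast_nonneg _))

end Model

end Summit.HubbardSuperconductivity.HubbardSuperconductivity.Theorems.KLRegimeSplit

end
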